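import Literature.NumberTheory.LFunctions.HardyZRiemannSiegelEvaluation
import Literature.NumberTheory.LFunctions.RiemannHypothesisUpToCertificate
import Literature.NumberTheory.LFunctions.HardyZSignCertificate
import Literature.NumberTheory.LFunctions.ZetaZerosSimpleOnLineUpTo
import Literature.NumberTheory.LFunctions.RiemannSiegelThetaBounds
import Mathlib.Order.Fin.Tuple
import HarnessLib

/-!
# A Turing-method certificate format for `RiemannHypothesisUpTo T` fed by the Riemann–Siegel
# evaluator (certified signs of Hardy's `Z` along dyadic sample runs)

Topic `Literature/NumberTheory/LFunctions` (with `Analysis/ValidatedNumerics`). The tree's fully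
proved Turing interface `Literature.NumberTheory.LFunctions.ZetaZerosSimpleOnLineUpTo.of_hardyZ_signs`
(`ZetaZerosSimpleOnLineUpTo.lean`; Turing–Lehman bound `abs_integral_zetaArgS_le_turing_holds`
proved in the tree) turns the DATA of a verification run — strict sign changes of Hardy's `Z` along
`0 ≤ t₀ < ⋯ < t_n ≤ T` and along `T ≤ s₀ < ⋯ < s_m ≤ T + h`, plus ONE real inequality — into
`ZetaZerosSimpleOnLineUpTo T ∧ N(T) = n ∧ N₀(T) = n` (hence `RiemannHypothesisUpTo T`). This file
is the executable checker that produces exactly these data from literal certificates, with the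
signs of `Z` certified by the Riemann–Siegel evaluator `Literature.NumberTheory.LFunctions.RSEval.hardyZBox`
(`HardyZRiemannSiegelEvaluation.lean`; conditional on Gabcke's remainder bound
`Literature.NumberTheory.LFunctions.Gabcke.satz322b_R0`) or, for the few samples where `|Z|` is
below its radius (close pairs of zeros; `t < 200`), by the Euler–Maclaurin evaluator
`Literature.NumberTheory.LFunctions.ZetaNumerics.zetaBoxK` and the rotation
`Literature.NumberTheory.LFunctions.hardyZ_pos_of_re_pos` (`HardyZSignCertificate.lean`).

* `signRS`, `signEM`, `signAt` — a certified sign of `Z(p/2^e)` (`some true` : `Z > 0`,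
  `some false` : `Z < 0`); soundness `hardyZ_sign_of_signRS`, `hardyZ_sign_of_signEM`.
* `AltRun e p s L` — the semantic content of a run: along the points `p, p + g₁, p + g₁ + g₂, …`
  (gaps `L`, all positive, unit `2^{-e}`) the signs of `Z` are certified and alternate, starting
  with `s` at `p`; `altRun_append` composes runs checked in different files;
  `exists_fin_of_altRun` converts a run into the `Fin`-indexed data of `of_hardyZ_signs`.
* `checkBlocks`, `checkChunk`, `checkStart` — the executable checks (blocks `(N, gaps)` share a
  method code: `N ≥ 1` = Riemann–Siegel with main-sum length `N`, `N = 0` = Euler–Maclaurin) and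
  their soundness `altRun_of_checkChunk`, `sgnZ_of_checkStart`.
* `checkHnum` and `hnum_of_checkHnum` — the Turing inequality
  `2.30 + 0.128 log((T+h)/2π) + ∫_T^{T+h}(ϑ/π + 1) − Σ_{j<m}(T + h − s_{j+1}) < h(n + 1)` in
  interval arithmetic, with `∫_T^{T+h} ϑ ≤ G(T+h) − G(T) + 2K(¼)h/T`,
  `G(x) = (x²/4) log(x/2π) − 3x²/8 − πx/8` (`integral_riemannSiegelTheta_le`, from the tree's
  `abs_riemannSiegelTheta_sub_stirling_le`).
* `zetaZerosSimpleOnLineUpTo_of_runs` — everything assembled: two runs + `checkHnum` ⇒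
  `ZetaZerosSimpleOnLineUpTo T ∧ N(T) = n ∧ N₀(T) = n`, conditional only on `Gabcke.satz322b_R0`
  (and, in the data files using it, on the `native_decide` axiom if compiled evaluation is chosen).

Everything here is proved; the file contains no certificate data.

## References

* W. Gabcke, Dissertation Göttingen 1979, Satz 3.2.2. [Gabcke1979]
* R. P. Brent, Math. Comp. 33 (1979), §3–§4 (sign changes; Theorems 3.1–3.2). [Brent1979]
* H. M. Edwards, *Riemann's Zeta Function* (1974), §6.5, §8.2 (Turing's method). [EdwardsZeta1974]
-/

open Finset Complex MeasureTheory intervalIntegral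
open Literature.Analysis.ValidatedNumerics Literature.Analysis.ValidatedNumerics.NumericsMP
open Literature.NumberTheory.LFunctions Literature.NumberTheory.LFunctions.ZetaNumerics
open Literature.NumberTheory.LFunctions.RSEval
open scoped Real

namespace Literature.NumberTheory.LFunctions.RSCert

/-! ## 1. Certified signs of `Z` -/

/-- The sign of `Z(p/2^e)` from the Riemann–Siegel enclosure `hardyZBox R p e N`
(`some true`: positive, `some false`: negative, `none`: undecided). [cite: Gabcke1979, Satz 3.2.2 (b) p. 55] -/
def signRS (R : RSTables) (e p N : ℕ) : Option Bool :=
  match hardyZBox R p e N with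
  | some B => if 0 < B.lo then some true else if B.hi < 0 then some false else none
  | none => none

/-- `log t` for `t = p/2^e` (as `RSEval.logT`), then the Stirling main term
`ϑ_m(t) = (t log(t/2π) − t)/2 − π/8`. [cite: EdwardsZeta1974, §6.5] -/
def thetaMainBox (R : RSTables) (e p : ℕ) : Option MI :=
  let S := R.T.S
  let tI := MI.ofFrac S p (2 ^ e)
  match logT R p e with
  | some lt =>
    some ((((MI.mul S tI ((lt.sub R.log2).sub R.logPi)).sub tI).divNat 2).sub (R.T.piI.divNat 8))
  | none => none

/-- The sign of `Z(p/2^e)` by Euler–Maclaurin and rotation: `Re(e^{iϑ_m} ζ(½ + it)) ≷ 0` with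
`|ϑ − ϑ_m| ≤ 2K(¼)/t < π/2` gives the sign of `Z(t)` (`hardyZ_pos_of_re_pos`); `ζ` from
`zetaBoxK` with the Euler–Maclaurin tables `T` (same scale as `R`). [cite: EdwardsZeta1974, §6.5] -/
def signEM (R : RSTables) (T : Tables) (e p : ℕ) : Option Bool :=
  let S := R.T.S
  let tI := MI.ofFrac S p (2 ^ e)
  if 2 * 2 ^ e ≤ p ∧ T.S = S then
    match thetaMainBox R e p, zetaBoxK T ⟨MI.ofFrac S 1 2, tI⟩, MI.divPos S R.twoK tI with
    | some thm, some Zb, some dl =>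
      match MC.expI S R.T.KI R.T.kI R.T.piI thm with
      | some E =>
        let w := (MC.mul S E Zb).re
        if 2 * dl.hi < R.T.piI.lo then
          (if 0 < w.lo then some true else if w.hi < 0 then some false else none)
        else none
      | none => none
    | _, _, _ => none
  else none

/-- The sign of `Z(p/2^e)` by the method with code `N`: `N = 0` Euler–Maclaurin, `N ≥ 1`
Riemann–Siegel with main-sum length `N`. [cite: Gabcke1979, Satz 3.2.2 (b) p. 55] -/
def signAt (R : RSTables) (T : Tables) (e N p : ℕ) : Option Bool :=
  if N = 0 then signEM R T e p else signRS R e p N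

/-- `Z(p/2^e) > 0` if `s = true`, `Z(p/2^e) < 0` if `s = false`. [cite: Brent1979, §3] -/
def sgnZ (e p : ℕ) (s : Bool) : Prop :=
  if s then 0 < hardyZ ((p : ℝ) / 2 ^ e) else hardyZ ((p : ℝ) / 2 ^ e) < 0

/-- Soundness of `signRS`. [cite: Gabcke1979, Satz 3.2.2 (b) p. 55] -/
theorem sgnZ_of_signRS (hG : Gabcke.satz322b_R0) {R : RSTables} (hR : R.Valid) {e p N : ℕ}
    {s : Bool} (h : signRS R e p N = some s) : sgnZ e p s := by
  unfold signRS at h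
  split at h
  · rename_i B hB
    have hm := mem_hardyZBox hG hR hB
    split_ifs at h with h1 h2
    · simp only [Option.some.injEq] at h
      subst h
      simpa [sgnZ] using MI.pos_of_lo_pos hm h1
    · simp only [Option.some.injEq] at h
      subst h
      simpa [sgnZ] using MI.neg_of_hi_neg hm h2
  · simp at h

/-- Soundness of `thetaMainBox`: `ϑ_m(p/2^e) ∈ thetaMainBox R e p` for `p ≥ 1`.
[cite: EdwardsZeta1974, §6.5] -/
theorem mem_thetaMainBox {R : RSTables} (hR : R.Valid) {e p : ℕ} (hp : 1 ≤ p) {Y : MI}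
    (h : thetaMainBox R e p = some Y) :
    MI.mem R.T.S ((p : ℝ) / 2 ^ e / 2 * Real.log ((p : ℝ) / 2 ^ e / (2 * π)) - (p : ℝ) / 2 ^ e / 2
      - π / 8) Y := by
  have hS := hR.T_valid.S_pos
  unfold thetaMainBox at h
  simp only at h
  split at h
  · rename_i lt hlt
    simp only [Option.some.injEq] at h
    subst h
    set t : ℝ := (p : ℝ) / 2 ^ e with ht
    have ht0 : 0 < t := by rw [ht]; exact div_pos (by exact_mod_cast hp) (by positivity)
    have htI : MI.mem R.T.S t (MI.ofFrac R.T.S p (2 ^ e)) := by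
      have := MI.mem_ofFrac R.T.S (p : ℤ) (q := 2 ^ e) (by positivity)
      have e1 : ((p : ℤ) : ℝ) / ((2 ^ e : ℕ) : ℝ) = t := by rw [ht]; push_cast; ring
      rwa [e1] at this
    -- `log t = log p − e log 2`
    have hlt' : MI.mem R.T.S (Real.log t) lt := by
      unfold logT at hlt
      split at hlt
      · rename_i lp hlp
        simp only [Option.some.injEq] at hlt
        subst hlt
        rw [logNatK_eq] at hlp
        have := MI.mem_sub (MI.mem_logNat hS hlp) (MI.mem_mulInt hR.mem_log2 (e : ℤ))
        convert this using 1
        have hp0 : (0 : ℝ) < p := by exact_mod_cast hp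
        rw [ht, Real.log_div hp0.ne' (by positivity), Real.log_pow]
        push_cast; ring
      · simp at hlt
    have hL : MI.mem R.T.S (Real.log (t / (2 * π))) ((lt.sub R.log2).sub R.logPi) := by
      have := MI.mem_sub (MI.mem_sub hlt' hR.mem_log2) hR.mem_logPi
      convert this using 1
      rw [Real.log_div ht0.ne' (by positivity), Real.log_mul (by norm_num) Real.pi_pos.ne']
      ring
    have := MI.mem_sub (MI.mem_divNat (MI.mem_sub (MI.mem_mul hS htI hL) htI) (n := 2)
      (by norm_num)) (MI.mem_divNat hR.T_valid.mem_pi (n := 8) (by norm_num))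
    convert this using 1
    push_cast; ring
  · simp at h

/-- Soundness of `signEM`. [cite: EdwardsZeta1974, §6.5] -/
theorem sgnZ_of_signEM {R : RSTables} (hR : R.Valid) {T : Tables} (hT : T.Valid) {e p : ℕ}
    {s : Bool} (h : signEM R T e p = some s) : sgnZ e p s := by
  have hS := hR.T_valid.S_pos
  have hSr : (0 : ℝ) < R.T.S := by exact_mod_cast hS
  have hpi := hR.T_valid.mem_pi
  unfold signEM at h
  simp only at h
  split_ifs at h with hc
  obtain ⟨h2, hTS⟩ := hc
  set t : ℝ := (p : ℝ) / 2 ^ e with ht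
  have h2e : (0 : ℝ) < 2 ^ e := by positivity
  have ht2 : 2 ≤ t := by
    rw [ht, le_div_iff₀ h2e]
    have : ((2 * 2 ^ e : ℕ) : ℝ) ≤ p := by exact_mod_cast h2
    push_cast at this; exact this
  have hp1 : 1 ≤ p := by
    by_contra hp; push Not at hp; interval_cases p; simp [ht] at ht2; linarith
  have htI : MI.mem R.T.S t (MI.ofFrac R.T.S p (2 ^ e)) := by
    have := MI.mem_ofFrac R.T.S (p : ℤ) (q := 2 ^ e) (by positivity)
    have e1 : ((p : ℤ) : ℝ) / ((2 ^ e : ℕ) : ℝ) = t := by rw [ht]; push_cast; ring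
    rwa [e1] at this
  split at h
  · rename_i thm Zb dl hthm hZb hdl
    split at h
    · rename_i E hE
      split_ifs at h with hang h1 h2
      · simp only [Option.some.injEq] at h
        subst h
        simp only [sgnZ, if_true]
        -- the rotation angle
        set θm : ℝ := t / 2 * Real.log (t / (2 * π)) - t / 2 - π / 8 with hθm
        have hthm' : MI.mem R.T.S θm thm := mem_thetaMainBox hR hp1 hthm
        have hE' := MC.mem_expI hS hpi hE hthm'
        have hsB : MC.mem T.S (1 / 2 + (t : ℂ) * I) ⟨MI.ofFrac R.T.S 1 2, MI.ofFrac R.T.S p (2 ^ e)⟩ := by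
          rw [hTS]
          refine ⟨?_, ?_⟩
          · have := MI.mem_ofFrac R.T.S 1 (q := 2) (by norm_num)
            simp only [add_re, one_div, mul_re, ofReal_re, I_re, mul_zero, ofReal_im, I_im,
              mul_one, sub_self, add_zero]
            convert this using 2; simp
          · simpa using htI
        have hne : (1 / 2 : ℂ) + (t : ℂ) * I ≠ 1 := fun h ↦ by
          have := congrArg Complex.im h; simp at this; linarith
        have hZ := mem_zetaBoxK hT hsB hne hZb
        rw [hTS] at hZ
        have hw := (MC.mem_mul hS hE' hZ).1
        have hre : 0 < (Complex.exp ((θm : ℂ) * I) * riemannZeta (1 / 2 + t * I)).re :=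
          MI.pos_of_lo_pos hw h1
        refine hardyZ_pos_of_re_pos (φ := θm) ?_ hre
        -- |θm − θ| ≤ 2K/t < π/2
        have hθ := abs_riemannSiegelTheta_sub_stirling_le (t := t) ht2
        rw [← hθm] at hθ
        have hdl' : MI.mem R.T.S (2 * stirlingVertRate (1 / 4) / t) dl :=
          MI.mem_divPos hS hdl hR.mem_twoK htI
        have hlt : 2 * stirlingVertRate (1 / 4) / t < π / 2 := by
          have a1 := hdl'.2
          have a2 := hpi.1
          have a3 : (2 : ℝ) * dl.hi < R.T.piI.lo := by exact_mod_cast hang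
          nlinarith
        rw [abs_sub_comm]
        linarith
      · simp only [Option.some.injEq] at h
        subst h
        simp only [sgnZ]
        set θm : ℝ := t / 2 * Real.log (t / (2 * π)) - t / 2 - π / 8 with hθm
        have hthm' : MI.mem R.T.S θm thm := mem_thetaMainBox hR hp1 hthm
        have hE' := MC.mem_expI hS hpi hE hthm'
        have hsB : MC.mem T.S (1 / 2 + (t : ℂ) * I) ⟨MI.ofFrac R.T.S 1 2, MI.ofFrac R.T.S p (2 ^ e)⟩ := by
          rw [hTS]
          refine ⟨?_, ?_⟩
          · have := MI.mem_ofFrac R.T.S 1 (q := 2) (by norm_num)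
            simp only [add_re, one_div, mul_re, ofReal_re, I_re, mul_zero, ofReal_im, I_im,
              mul_one, sub_self, add_zero]
            convert this using 2; simp
          · simpa using htI
        have hne : (1 / 2 : ℂ) + (t : ℂ) * I ≠ 1 := fun h ↦ by
          have := congrArg Complex.im h; simp at this; linarith
        have hZ := mem_zetaBoxK hT hsB hne hZb
        rw [hTS] at hZ
        have hw := (MC.mem_mul hS hE' hZ).1
        have hre : (Complex.exp ((θm : ℂ) * I) * riemannZeta (1 / 2 + t * I)).re < 0 :=
          MI.neg_of_hi_neg hw h2
        simp only [Bool.false_eq_true, ↓reduceIte]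
        refine hardyZ_neg_of_re_neg (φ := θm) ?_ hre
        have hθ := abs_riemannSiegelTheta_sub_stirling_le (t := t) ht2
        rw [← hθm] at hθ
        have hdl' : MI.mem R.T.S (2 * stirlingVertRate (1 / 4) / t) dl :=
          MI.mem_divPos hS hdl hR.mem_twoK htI
        have hlt : 2 * stirlingVertRate (1 / 4) / t < π / 2 := by
          have a1 := hdl'.2
          have a2 := hpi.1
          have a3 : (2 : ℝ) * dl.hi < R.T.piI.lo := by exact_mod_cast hang
          nlinarith
        rw [abs_sub_comm]
        linarith
    · simp at h
  · simp at h

/-- Soundness of `signAt`. [cite: Gabcke1979, Satz 3.2.2 (b) p. 55] -/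
theorem sgnZ_of_signAt (hG : Gabcke.satz322b_R0) {R : RSTables} (hR : R.Valid) {T : Tables}
    (hT : T.Valid) {e N p : ℕ} {s : Bool} (h : signAt R T e N p = some s) : sgnZ e p s := by
  unfold signAt at h
  split_ifs at h
  · exact sgnZ_of_signEM hR hT h
  · exact sgnZ_of_signRS hG hR h

/-! ## 2. Runs of alternating certified signs -/

/-- **A run**: along the points `p, p + g₁, p + g₁ + g₂, …` (unit `2^{-e}`, gaps `gᵢ > 0`) the
signs of `Z` are certified and alternate, starting with sign `s` at `p`. [cite: Brent1979, §3] -/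
def AltRun (e : ℕ) : ℕ → Bool → List ℕ → Prop
  | p, s, [] => sgnZ e p s
  | p, s, g :: gs => sgnZ e p s ∧ 0 < g ∧ AltRun e (p + g) (!s) gs

/-- The first point of a run has the run's initial sign. [cite: Brent1979, §3] -/
lemma AltRun.head {e p : ℕ} {s : Bool} : ∀ {L : List ℕ}, AltRun e p s L → sgnZ e p s
  | [], h => h
  | _ :: _, h => h.1

/-- Two certified signs at the same point agree. [cite: Brent1979, §3] -/
lemma sgnZ_unique {e p : ℕ} {s s' : Bool} (h : sgnZ e p s) (h' : sgnZ e p s') : s = s' := by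
  unfold sgnZ at h h'
  cases s <;> cases s' <;> simp at h h' ⊢ <;> linarith

/-- **Composition of runs** checked separately: a run with gaps `L₁` from `p` and a run with gaps
`L₂` from `p + ΣL₁` make a run with gaps `L₁ ++ L₂` (the junction sign is certified twice, so no
parity bookkeeping is needed). [cite: Brent1979, §3] -/
theorem altRun_append {e : ℕ} : ∀ {L₁ L₂ : List ℕ} {p : ℕ} {s s₂ : Bool},
    AltRun e p s L₁ → AltRun e (p + L₁.sum) s₂ L₂ → AltRun e p s (L₁ ++ L₂)
  | [], L₂, p, s, s₂, h1, h2 => by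
    simp only [List.sum_nil, add_zero] at h2
    have := sgnZ_unique h1 h2.head
    subst this
    simpa using h2
  | g :: gs, L₂, p, s, s₂, h1, h2 => by
    obtain ⟨hp, hg, hrest⟩ := h1
    refine ⟨hp, hg, ?_⟩
    have h2' : AltRun e (p + g + gs.sum) s₂ L₂ := by
      simpa [List.sum_cons, add_assoc] using h2
    exact altRun_append hrest h2'

/-- Sum of the points of a run after the first: `Σ_{j=1}^{m} (p + g₁ + ⋯ + g_j)`. [folklore] -/
def sumPts : ℕ → List ℕ → ℕ
  | _, [] => 0
  | p, g :: gs => (p + g) + sumPts (p + g) gs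

/-- Opposite certified signs give a negative product. [cite: Brent1979, §3] -/
lemma mul_neg_of_sgnZ {e p q : ℕ} {s : Bool} (h1 : sgnZ e p s) (h2 : sgnZ e q (!s)) :
    hardyZ ((p : ℝ) / 2 ^ e) * hardyZ ((q : ℝ) / 2 ^ e) < 0 := by
  unfold sgnZ at h1 h2
  cases s
  · simp at h1 h2; exact mul_neg_of_neg_of_pos h1 h2
  · simp at h1 h2; exact mul_neg_of_pos_of_neg h1 h2

/-- **From a run to `Fin`-indexed verification data**: a strictly increasing vector
`t₀ < ⋯ < t_n` (`n = |L|`) of sample points with `t₀ = p/2^e`, `t_n = (p + ΣL)/2^e`,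
strict sign changes of `Z` between consecutive points, and `Σ_{i<n} t_{i+1} = sumPts p L / 2^e`.
[cite: Brent1979, §3 Theorems 3.1–3.2] -/
theorem exists_fin_of_altRun {e : ℕ} : ∀ (L : List ℕ) (p : ℕ) (s : Bool), AltRun e p s L →
    ∃ t : Fin (L.length + 1) → ℝ, StrictMono t ∧ t 0 = (p : ℝ) / 2 ^ e ∧
      t (Fin.last L.length) = ((p + L.sum : ℕ) : ℝ) / 2 ^ e ∧
      (∀ i : Fin L.length, hardyZ (t i.castSucc) * hardyZ (t i.succ) < 0) ∧
      ∑ i : Fin L.length, t i.succ = (sumPts p L : ℝ) / 2 ^ e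
  | [], p, s, _ => by
    have : Subsingleton (Fin (([] : List ℕ).length + 1)) := by
      show Subsingleton (Fin 1); infer_instance
    exact ⟨fun _ ↦ (p : ℝ) / 2 ^ e, Subsingleton.strictMono _, rfl, by simp, fun i ↦ i.elim0,
      by simp [sumPts]⟩
  | g :: gs, p, s, h => by
    obtain ⟨hp, hg, hrest⟩ := h
    obtain ⟨t', hmono, h0, hlast, hsign, hsum⟩ := exists_fin_of_altRun gs (p + g) (!s) hrest
    refine ⟨Fin.cons ((p : ℝ) / 2 ^ e) t', ?_, rfl, ?_, ?_, ?_⟩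
    · refine (Fin.strictMono_iff_lt_succ).2 fun i ↦ ?_
      refine Fin.cases ?_ (fun j ↦ ?_) i
      · simp only [Fin.castSucc_zero, Fin.cons_zero, Fin.succ_zero_eq_one]
        rw [show (1 : Fin (gs.length + 1 + 1)) = Fin.succ 0 from rfl, Fin.cons_succ, h0]
        have : (0 : ℝ) < g := by exact_mod_cast hg
        push_cast
        exact div_lt_div_of_pos_right (by linarith) (by positivity)
      · rw [← Fin.succ_castSucc, Fin.cons_succ, Fin.cons_succ]
        exact hmono j.castSucc_lt_succ
    · rw [show Fin.last (g :: gs).length = Fin.succ (Fin.last gs.length) from rfl, Fin.cons_succ,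
        hlast]
      simp [List.sum_cons, add_assoc]
    · intro i
      refine Fin.cases ?_ (fun j ↦ ?_) i
      · simp only [Fin.castSucc_zero, Fin.cons_zero, Fin.succ_zero_eq_one]
        rw [show (1 : Fin (gs.length + 1 + 1)) = Fin.succ 0 from rfl, Fin.cons_succ, h0]
        have := mul_neg_of_sgnZ hp hrest.head
        push_cast at this ⊢
        exact this
      · rw [← Fin.succ_castSucc, Fin.cons_succ, Fin.cons_succ]
        exact hsign j
    · show ∑ i : Fin (gs.length + 1),
          (Fin.cons ((p : ℝ) / 2 ^ e) t' : Fin (gs.length + 1 + 1) → ℝ) i.succ = _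
      rw [Fin.sum_univ_succ]
      simp only [Fin.cons_succ]
      rw [h0, hsum]
      simp only [sumPts]
      push_cast
      ring

/-! ## 3. The executable run checks -/

/-- Check one block of gaps with method code `N`, from the point `p` whose sign `s` is already
certified: every gap is positive and the sign at the next point is certified opposite. Returns the
last point and its sign. [cite: Brent1979, §3] -/
def checkGaps (R : RSTables) (T : Tables) (e N : ℕ) : ℕ → Bool → List ℕ → Option (ℕ × Bool)
  | p, s, [] => some (p, s)
  | p, s, g :: gs =>
    if 0 < g ∧ signAt R T e N (p + g) = some (!s) then checkGaps R T e N (p + g) (!s) gs else none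

/-- Check a list of blocks `(N, gaps)`. [cite: Brent1979, §3] -/
def checkBlocks (R : RSTables) (T : Tables) (e : ℕ) : ℕ → Bool → List (ℕ × List ℕ) → Option (ℕ × Bool)
  | p, s, [] => some (p, s)
  | p, s, (N, gs) :: bs =>
    match checkGaps R T e N p s gs with
    | some (p', s') => checkBlocks R T e p' s' bs
    | none => none

/-- The gap list of a block list. [folklore] -/
def flatten : List (ℕ × List ℕ) → List ℕ
  | [] => []
  | (_, gs) :: bs => gs ++ flatten bs

/-- Soundness of `checkGaps`. [cite: Brent1979, §3] -/
theorem altRun_of_checkGaps (hG : Gabcke.satz322b_R0) {R : RSTables} (hR : R.Valid) {T : Tables}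
    (hT : T.Valid) {e N : ℕ} : ∀ (gs : List ℕ) (p : ℕ) (s : Bool) {p' : ℕ} {s' : Bool},
    sgnZ e p s → checkGaps R T e N p s gs = some (p', s') →
      AltRun e p s gs ∧ p + gs.sum = p' ∧ sgnZ e p' s'
  | [], p, s, p', s', hp, h => by
    simp only [checkGaps, Option.some.injEq, Prod.mk.injEq] at h
    obtain ⟨rfl, rfl⟩ := h
    exact ⟨hp, by simp, hp⟩
  | g :: gs, p, s, p', s', hp, h => by
    simp only [checkGaps] at h
    split_ifs at h with hc
    obtain ⟨hg, hsg⟩ := hc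
    have hnext := sgnZ_of_signAt hG hR hT hsg
    obtain ⟨hrun, hsum, hlast⟩ := altRun_of_checkGaps hG hR hT gs (p + g) (!s) hnext h
    exact ⟨⟨hp, hg, hrun⟩, by simp [List.sum_cons, ← hsum, add_assoc], hlast⟩

/-- Soundness of `checkBlocks`. [cite: Brent1979, §3] -/
theorem altRun_of_checkBlocks (hG : Gabcke.satz322b_R0) {R : RSTables} (hR : R.Valid) {T : Tables}
    (hT : T.Valid) {e : ℕ} : ∀ (bs : List (ℕ × List ℕ)) (p : ℕ) (s : Bool) {p' : ℕ} {s' : Bool},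
    sgnZ e p s → checkBlocks R T e p s bs = some (p', s') →
      AltRun e p s (flatten bs) ∧ p + (flatten bs).sum = p' ∧ sgnZ e p' s'
  | [], p, s, p', s', hp, h => by
    simp only [checkBlocks, Option.some.injEq, Prod.mk.injEq] at h
    obtain ⟨rfl, rfl⟩ := h
    exact ⟨by simpa [flatten, AltRun] using hp, by simp [flatten], hp⟩
  | (N, gs) :: bs, p, s, p', s', hp, h => by
    simp only [checkBlocks] at h
    split at h
    · rename_i p₁ s₁ h₁
      obtain ⟨hrun₁, hsum₁, hlast₁⟩ := altRun_of_checkGaps hG hR hT gs p s hp h₁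
      obtain ⟨hrun₂, hsum₂, hlast₂⟩ := altRun_of_checkBlocks hG hR hT bs p₁ s₁ hlast₁ h
      refine ⟨?_, ?_, hlast₂⟩
      · simp only [flatten]
        exact altRun_append hrun₁ (hsum₁ ▸ hrun₂)
      · simp [flatten, List.sum_append, ← hsum₂, ← hsum₁, add_assoc]
    · simp at h

/-- **The chunk check** with tables built inside (Riemann–Siegel tables for main sums of length
`≤ Nrs`, Euler–Maclaurin tables of cut-off `Nem` and order `ν`, both at scale `2^60`): from the
point `p` with known sign `s`, check the blocks `bs`. [cite: Brent1979, §3] -/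
def checkChunk (Nrs Nem nu e p : ℕ) (s : Bool) (bs : List (ℕ × List ℕ)) : Option (ℕ × Bool) :=
  match rsTablesWith Nrs, RHUpToCert.tablesWith Nem nu with
  | some R, some T => checkBlocks R T e p s bs
  | _, _ => none

/-- **The start check**: the sign `s` at the first point `p` of a run, certified directly.
[cite: Brent1979, §3] -/
def checkStart (Nrs Nem nu e N p : ℕ) (s : Bool) : Bool :=
  match rsTablesWith Nrs, RHUpToCert.tablesWith Nem nu with
  | some R, some T => decide (signAt R T e N p = some s)
  | _, _ => false

/-- Soundness of `checkStart`. [cite: Brent1979, §3] -/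
theorem sgnZ_of_checkStart (hG : Gabcke.satz322b_R0) {Nrs Nem nu e N p : ℕ} {s : Bool}
    (h : checkStart Nrs Nem nu e N p s = true) : sgnZ e p s := by
  unfold checkStart at h
  split at h
  · rename_i R T hR hT
    exact sgnZ_of_signAt hG (rsTablesWith_valid hR) (RHUpToCert.tablesWith_valid hT)
      (of_decide_eq_true h)
  · simp at h

/-- **Soundness of the chunk check**: if the sign `s` at `p` is certified (by `checkStart` or by
the previous chunk) and `checkChunk … p s bs = some (p', s')`, then the gaps `flatten bs` form a
run from `p` with initial sign `s`, ending at `p' = p + Σ` with certified sign `s'`.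
[cite: Brent1979, §3] -/
theorem altRun_of_checkChunk (hG : Gabcke.satz322b_R0) {Nrs Nem nu e p : ℕ} {s : Bool}
    {bs : List (ℕ × List ℕ)} {p' : ℕ} {s' : Bool} (hp : sgnZ e p s)
    (h : checkChunk Nrs Nem nu e p s bs = some (p', s')) :
    AltRun e p s (flatten bs) ∧ p + (flatten bs).sum = p' ∧ sgnZ e p' s' := by
  unfold checkChunk at h
  split at h
  · rename_i R T hR hT
    exact altRun_of_checkBlocks hG (rsTablesWith_valid hR) (RHUpToCert.tablesWith_valid hT) bs p s hp h
  · simp at h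

/-! ## 4. The Turing inequality -/

/-- `G(x) = (x²/4) log(x/2π) − 3x²/8 − πx/8`, a primitive of the Stirling main term
`ϑ_m(x) = (x/2) log(x/2π) − x/2 − π/8`. [cite: EdwardsZeta1974, §6.5] -/
noncomputable def thetaMainPrim (x : ℝ) : ℝ :=
  x ^ 2 / 4 * Real.log (x / (2 * π)) - 3 * x ^ 2 / 8 - π * x / 8

/-- `G' = ϑ_m` on `(0, ∞)`. [cite: EdwardsZeta1974, §6.5] -/
theorem hasDerivAt_thetaMainPrim {x : ℝ} (hx : 0 < x) :
    HasDerivAt thetaMainPrim (x / 2 * Real.log (x / (2 * π)) - x / 2 - π / 8) x := by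
  have h2pi : (0 : ℝ) < 2 * π := by positivity
  have hx0 : x ≠ 0 := hx.ne'
  have hx' : id x / (2 * π) ≠ 0 := (div_pos hx h2pi).ne'
  have h1 : HasDerivAt (fun y : ℝ ↦ id y / (2 * π)) (1 / (2 * π)) x :=
    (hasDerivAt_id x).div_const (2 * π)
  have hlog := h1.log hx'
  have hsq := (hasDerivAt_pow 2 x).div_const 4
  have hB := ((hasDerivAt_pow 2 x).const_mul (3 : ℝ)).div_const 8
  have hC := ((hasDerivAt_id x).const_mul π).div_const 8
  have h := ((hsq.fun_mul hlog).fun_sub hB).fun_sub hC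
  unfold thetaMainPrim
  refine h.congr_deriv ?_
  simp only [Nat.cast_ofNat, id, Nat.add_one_sub_one, pow_one]
  field_simp
  ring

/-- **Upper bound for `∫ ϑ`**: for `2 ≤ T`, `0 ≤ h`,
`∫_T^{T+h} ϑ(t) dt ≤ G(T+h) − G(T) + 2K(¼) h / T` (from `|ϑ − ϑ_m| ≤ 2K(¼)/t`,
`abs_riemannSiegelTheta_sub_stirling_le`, and `G' = ϑ_m`). [cite: EdwardsZeta1974, §6.5 and §8.2] -/
theorem integral_riemannSiegelTheta_le {T h : ℝ} (hT : 2 ≤ T) (hh : 0 ≤ h) :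
    ∫ t in T..T + h, riemannSiegelTheta t ≤
      thetaMainPrim (T + h) - thetaMainPrim T + 2 * stirlingVertRate (1 / 4) * h / T := by
  have hT0 : 0 < T := by linarith
  set c : ℝ := 2 * stirlingVertRate (1 / 4) / T with hc
  have hK : 0 ≤ stirlingVertRate (1 / 4) := by unfold stirlingVertRate; positivity
  -- pointwise bound on [T, T+h]
  have hpt : ∀ t ∈ Set.Icc T (T + h), riemannSiegelTheta t ≤
      (t / 2 * Real.log (t / (2 * π)) - t / 2 - π / 8) + c := by
    intro t ht
    have ht2 : 2 ≤ t := hT.trans ht.1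
    have ht0 : 0 < t := by linarith
    have h1 := (abs_le.1 (abs_riemannSiegelTheta_sub_stirling_le ht2)).2
    have h2 : 2 * stirlingVertRate (1 / 4) / t ≤ c := by
      rw [hc]
      exact div_le_div_of_nonneg_left (by positivity) hT0 ht.1
    linarith
  have hcont0 : ContinuousOn (fun t : ℝ ↦ t / 2 * Real.log (t / (2 * π)) - t / 2 - π / 8)
      (Set.uIcc T (T + h)) := by
    intro t ht
    rw [Set.uIcc_of_le (by linarith)] at ht
    have ht0 : 0 < t := by linarith [ht.1]
    apply ContinuousAt.continuousWithinAt
    have hl : ContinuousAt (fun z : ℝ ↦ Real.log (z / (2 * π))) t :=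
      ContinuousAt.log (continuousAt_id.div_const (2 * π))
        (by simpa using (div_pos ht0 (by positivity : (0 : ℝ) < 2 * π)).ne')
    exact (((continuousAt_id.div_const (2 : ℝ)).mul hl).sub (continuousAt_id.div_const (2 : ℝ))).sub
      continuousAt_const
  have hcont : ContinuousOn (fun t : ℝ ↦ (t / 2 * Real.log (t / (2 * π)) - t / 2 - π / 8) + c)
      (Set.uIcc T (T + h)) := hcont0.add continuousOn_const
  have hderiv : ∀ x ∈ Set.uIcc T (T + h),
      HasDerivAt thetaMainPrim (x / 2 * Real.log (x / (2 * π)) - x / 2 - π / 8) x := by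
    intro x hx
    rw [Set.uIcc_of_le (by linarith)] at hx
    exact hasDerivAt_thetaMainPrim (by linarith [hx.1])
  have hmono := intervalIntegral.integral_mono_on (by linarith : T ≤ T + h)
    (intervalIntegrable_riemannSiegelTheta T (T + h)) hcont.intervalIntegrable hpt
  refine hmono.trans (le_of_eq ?_)
  rw [intervalIntegral.integral_add hcont0.intervalIntegrable intervalIntegrable_const,
    intervalIntegral.integral_const, smul_eq_mul,
    intervalIntegral.integral_eq_sub_of_hasDerivAt hderiv hcont0.intervalIntegrable, hc]
  ring

/-- `G(x)` for a natural number `x ≥ 1` in interval arithmetic. [cite: EdwardsZeta1974, §6.5] -/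
def thetaMainPrimBox (R : RSTables) (x : ℕ) : Option MI :=
  let S := R.T.S
  match logNatK S R.Klog x with
  | some lx =>
    let L := (lx.sub R.log2).sub R.logPi
    some ((((MI.mul S L (MI.ofInt S ((x * x : ℕ) : ℤ))).divNat 4).sub
      (MI.ofFrac S ((3 * x * x : ℕ) : ℤ) 8)).sub ((R.T.piI.mulInt (x : ℤ)).divNat 8))
  | none => none

/-- Soundness of `thetaMainPrimBox`. [cite: EdwardsZeta1974, §6.5] -/
theorem mem_thetaMainPrimBox {R : RSTables} (hR : R.Valid) {x : ℕ} (hx : 1 ≤ x) {Y : MI}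
    (h : thetaMainPrimBox R x = some Y) : MI.mem R.T.S (thetaMainPrim x) Y := by
  have hS := hR.T_valid.S_pos
  unfold thetaMainPrimBox at h
  simp only at h
  split at h
  · rename_i lx hlx
    simp only [Option.some.injEq] at h
    subst h
    rw [logNatK_eq] at hlx
    have hx0 : (0 : ℝ) < x := by exact_mod_cast hx
    have hL : MI.mem R.T.S (Real.log ((x : ℝ) / (2 * π))) ((lx.sub R.log2).sub R.logPi) := by
      have := MI.mem_sub (MI.mem_sub (MI.mem_logNat hS hlx) hR.mem_log2) hR.mem_logPi
      convert this using 1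
      rw [Real.log_div hx0.ne' (by positivity), Real.log_mul (by norm_num) Real.pi_pos.ne']
      ring
    have := MI.mem_sub (MI.mem_sub (MI.mem_divNat (MI.mem_mul hS hL
      (MI.mem_ofInt R.T.S ((x * x : ℕ) : ℤ))) (n := 4) (by norm_num))
      (MI.mem_ofFrac R.T.S ((3 * x * x : ℕ) : ℤ) (q := 8) (by norm_num)))
      (MI.mem_divNat (MI.mem_mulInt hR.T_valid.mem_pi (x : ℤ)) (n := 8) (by norm_num))
    convert this using 1
    unfold thetaMainPrim
    push_cast; ring
  · simp at h

/-- **The Turing inequality check** for the claim `N(T₀) = n` with the found-zero run `(q₀, M)`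
on `[T₀, T₀ + h]` (unit `2^{-e}`): an upper bound of
`2.30 + 0.128 log((T₀+h)/2π) + (G(T₀+h) − G(T₀) + 2K(¼)h/T₀)/π + h − Σ_{j=1}^{m}(T₀ + h − s_j)`
is `< h(n + 1)`. [cite: EdwardsZeta1974, §8.2 (1)] -/
def checkHnumWith (R : RSTables) (e T0 h n q0 : ℕ) (M : List ℕ) : Bool :=
  let S := R.T.S
  match logNatK S R.Klog (T0 + h), thetaMainPrimBox R (T0 + h), thetaMainPrimBox R T0,
    MI.divPos S (R.twoK.mulInt (h : ℤ)) (MI.ofInt S T0) with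
  | some lTh, some G1, some G0, some K =>
    let A := (MI.ofFrac S 230 100).add ((((lTh.sub R.log2).sub R.logPi).mulInt 128).divNat 1000)
    match MI.divPos S ((G1.sub G0).add K) R.T.piI with
    | some I =>
      let sigma := MI.ofFrac S ((M.length * (T0 + h) * 2 ^ e : ℕ) - (sumPts q0 M : ℤ)) (2 ^ e)
      let lhs := ((A.add I).add (MI.ofInt S h)).sub sigma
      decide (lhs.hi < ((h * (n + 1) : ℕ) : ℤ) * S)
    | none => false
  | _, _, _, _ => false

/-- The Turing inequality check with tables built inside. [cite: EdwardsZeta1974, §8.2 (1)] -/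
def checkHnum (Nrs e T0 h n q0 : ℕ) (M : List ℕ) : Bool :=
  match rsTablesWith Nrs with
  | some R => decide (2 ≤ T0) && checkHnumWith R e T0 h n q0 M
  | none => false

/-- Soundness of `checkHnumWith`: the real Turing inequality with `∫ ϑ` bounded by
`integral_riemannSiegelTheta_le`. [cite: EdwardsZeta1974, §8.2 (1)] -/
theorem hnum_of_checkHnumWith {R : RSTables} (hR : R.Valid) {e T0 h n q0 : ℕ} {M : List ℕ}
    (hT2 : 2 ≤ T0) (hc : checkHnumWith R e T0 h n q0 M = true) :
    2.30 + 0.128 * Real.log (((T0 : ℝ) + h) / (2 * π))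
        + (∫ t in (T0 : ℝ)..(T0 : ℝ) + h, (riemannSiegelTheta t / π + 1))
        - ((M.length : ℝ) * ((T0 : ℝ) + h) - (sumPts q0 M : ℝ) / 2 ^ e)
        < (h : ℝ) * (n + 1) := by
  have hS := hR.T_valid.S_pos
  have hSr : (0 : ℝ) < R.T.S := by exact_mod_cast hS
  have hpi := hR.T_valid.mem_pi
  have hT0r : (2 : ℝ) ≤ T0 := by exact_mod_cast hT2
  have hT0pos : (0 : ℝ) < T0 := by linarith
  unfold checkHnumWith at hc
  simp only at hc
  split at hc
  · rename_i lTh G1 G0 K hlTh hG1 hG0 hK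
    split at hc
    · rename_i I hI
      have hdec := of_decide_eq_true hc
      rw [logNatK_eq] at hlTh
      have hTh1 : 1 ≤ T0 + h := by omega
      -- A ∋ 2.30 + 0.128 log((T0+h)/2π)
      have hlog : MI.mem R.T.S (Real.log (((T0 : ℝ) + h) / (2 * π))) ((lTh.sub R.log2).sub R.logPi) := by
        have := MI.mem_sub (MI.mem_sub (MI.mem_logNat hS hlTh) hR.mem_log2) hR.mem_logPi
        convert this using 1
        push_cast
        rw [Real.log_div (by positivity) (by positivity), Real.log_mul (by norm_num) Real.pi_pos.ne']
        ring
      have hA : MI.mem R.T.S (2.30 + 0.128 * Real.log (((T0 : ℝ) + h) / (2 * π)))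
          ((MI.ofFrac R.T.S 230 100).add ((((lTh.sub R.log2).sub R.logPi).mulInt 128).divNat 1000)) := by
        have := MI.mem_add (MI.mem_ofFrac R.T.S 230 (q := 100) (by norm_num))
          (MI.mem_divNat (MI.mem_mulInt hlog 128) (n := 1000) (by norm_num))
        convert this using 1
        norm_num; ring
      -- I ∋ (G(T0+h) − G(T0) + 2K h/T0)/π  ≥ ∫ θ/π
      have hG1' := mem_thetaMainPrimBox hR hTh1 hG1
      have hG0' := mem_thetaMainPrimBox hR (by omega) hG0
      have hK' : MI.mem R.T.S (2 * stirlingVertRate (1 / 4) * h / T0) K := by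
        have := MI.mem_divPos hS hK (MI.mem_mulInt hR.mem_twoK (h : ℤ)) (MI.mem_ofInt R.T.S (T0 : ℤ))
        convert this using 1
        push_cast; ring
      have hI' : MI.mem R.T.S ((thetaMainPrim ((T0 : ℝ) + h) - thetaMainPrim T0 +
          2 * stirlingVertRate (1 / 4) * h / T0) / π) I := by
        have := MI.mem_divPos hS hI (MI.mem_add (MI.mem_sub hG1' hG0') hK') hpi
        convert this using 2
        push_cast; ring
      -- sigma
      have hsig : MI.mem R.T.S ((M.length : ℝ) * ((T0 : ℝ) + h) - (sumPts q0 M : ℝ) / 2 ^ e)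
          (MI.ofFrac R.T.S ((M.length * (T0 + h) * 2 ^ e : ℕ) - (sumPts q0 M : ℤ)) (2 ^ e)) := by
        have := MI.mem_ofFrac R.T.S (((M.length * (T0 + h) * 2 ^ e : ℕ) : ℤ) - (sumPts q0 M : ℤ))
          (q := 2 ^ e) (by positivity)
        convert this using 1
        push_cast
        field_simp
      have hh : MI.mem R.T.S (h : ℝ) (MI.ofInt R.T.S h) := by exact_mod_cast MI.mem_ofInt R.T.S (h : ℤ)
      have hlhs := MI.mem_sub (MI.mem_add (MI.mem_add hA hI') hh) hsig
      have hup := hlhs.2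
      -- the integral
      have hint : (∫ t in (T0 : ℝ)..(T0 : ℝ) + h, (riemannSiegelTheta t / π + 1)) ≤
          (thetaMainPrim ((T0 : ℝ) + h) - thetaMainPrim T0 + 2 * stirlingVertRate (1 / 4) * h / T0) / π
            + h := by
        have hθint := intervalIntegrable_riemannSiegelTheta (T0 : ℝ) ((T0 : ℝ) + h)
        rw [intervalIntegral.integral_add (hθint.div_const π) intervalIntegrable_const,
          intervalIntegral.integral_const, smul_eq_mul, mul_one, intervalIntegral.integral_div]
        have h1 := integral_riemannSiegelTheta_le (T := (T0 : ℝ)) (h := (h : ℝ)) hT0r (by positivity)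
        have h2 := div_le_div_of_nonneg_right h1 Real.pi_pos.le
        have : (T0 : ℝ) + h - T0 = h := by ring
        rw [this]
        linarith
      -- read off
      have hdec' : ((((((MI.ofFrac R.T.S 230 100).add ((((lTh.sub R.log2).sub R.logPi).mulInt 128).divNat
          1000)).add I).add (MI.ofInt R.T.S ↑h)).sub (MI.ofFrac R.T.S (↑(M.length * (T0 + h) * 2 ^ e) -
          ↑(sumPts q0 M)) (2 ^ e))).hi : ℝ) < ((h * (n + 1) : ℕ) : ℝ) * R.T.S := by
        exact_mod_cast hdec
      have key : (2.30 + 0.128 * Real.log (((T0 : ℝ) + h) / (2 * π)) +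
          ((thetaMainPrim ((T0 : ℝ) + h) - thetaMainPrim T0 + 2 * stirlingVertRate (1 / 4) * h / T0) / π)
          + h - ((M.length : ℝ) * ((T0 : ℝ) + h) - (sumPts q0 M : ℝ) / 2 ^ e)) * R.T.S <
          ((h * (n + 1) : ℕ) : ℝ) * R.T.S := lt_of_le_of_lt hup hdec'
      have key' := lt_of_mul_lt_mul_right key hSr.le
      push_cast at key' ⊢
      nlinarith [key', hint]
    · simp at hc
  · simp at hc

/-! ## 5. Assembly -/

/-- `168π < 528`. [folklore] -/
private lemma pi_168_lt : 168 * π < (528 : ℝ) := by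
  have := Real.pi_lt_d4; nlinarith

/-- **RH up to `T₀` from two certified runs and the Turing inequality.** Let the low run
`AltRun e p₀ s₀ L` (`|L| = n`) end at `p₀ + ΣL ≤ T₀ 2^e` and the Turing run `AltRun e q₀ s₁ M` lie
in `[T₀ 2^e, (T₀ + h) 2^e]`, `528 ≤ T₀` (`> 168π`), `0 < h`, and let `checkHnum` accept for `n`.
Then every zero of `ζ` with `0 < Im ρ ≤ T₀` is simple and on the critical line, and
`N(T₀) = N₀(T₀) = |L|` (`ZetaZerosSimpleOnLineUpTo.of_hardyZ_signs`, whose Turing–Lehman bound is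
proved in the tree). Conditional on nothing but the hypotheses producing the runs (the named fact
`Gabcke.satz322b_R0` when `signRS` is used). [cite: Brent1979, §3 Theorems 3.1–3.2 and §4]
[cite: EdwardsZeta1974, §8.2 (1)] -/
theorem zetaZerosSimpleOnLineUpTo_of_runs {e p0 q0 T0 h Nrs n : ℕ} {s0 s1 : Bool} {L M : List ℕ}
    (hlow : AltRun e p0 s0 L) (hup : AltRun e q0 s1 M) (hT0 : 528 ≤ T0) (hh : 0 < h)
    (hend : p0 + L.sum ≤ T0 * 2 ^ e) (hq0 : T0 * 2 ^ e ≤ q0) (hqend : q0 + M.sum ≤ (T0 + h) * 2 ^ e)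
    (hn : L.length = n) (hnum : checkHnum Nrs e T0 h n q0 M = true) :
    ZetaZerosSimpleOnLineUpTo (T0 : ℝ) ∧ zetaZeroCount (T0 : ℝ) = n ∧
      criticalZeroCount (T0 : ℝ) = n := by
  subst hn
  have h2e : (0 : ℝ) < 2 ^ e := by positivity
  obtain ⟨t, ht, ht0, htn, htsign, -⟩ := exists_fin_of_altRun L p0 s0 hlow
  obtain ⟨s, hs, hs0, hsm, hssign, hssum⟩ := exists_fin_of_altRun M q0 s1 hup
  have hT0r : (528 : ℝ) ≤ T0 := by exact_mod_cast hT0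
  have hTpi : 168 * π < (T0 : ℝ) := lt_of_lt_of_le pi_168_lt hT0r
  have hhr : (0 : ℝ) < h := by exact_mod_cast hh
  -- the Turing inequality
  unfold checkHnum at hnum
  split at hnum
  · rename_i R hR
    simp only [Bool.and_eq_true, decide_eq_true_eq] at hnum
    obtain ⟨hT2, hc⟩ := hnum
    have hineq := hnum_of_checkHnumWith (rsTablesWith_valid hR) hT2 hc
    have hsum_eq : ∑ i : Fin M.length, ((T0 : ℝ) + h - s i.succ) =
        (M.length : ℝ) * ((T0 : ℝ) + h) - (sumPts q0 M : ℝ) / 2 ^ e := by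
      rw [Finset.sum_sub_distrib, hssum, Finset.sum_const, Finset.card_univ, Fintype.card_fin,
        nsmul_eq_mul]
    refine ZetaZerosSimpleOnLineUpTo.of_hardyZ_signs (T := (T0 : ℝ)) (h := (h : ℝ)) hTpi hhr
      t ht ?_ ?_ htsign s hs ?_ ?_ hssign ?_
    · rw [ht0]; positivity
    · rw [htn, div_le_iff₀ h2e]; exact_mod_cast hend
    · rw [hs0, le_div_iff₀ h2e]; exact_mod_cast hq0
    · rw [hsm, div_le_iff₀ h2e]; exact_mod_cast hqend
    · rw [hsum_eq]
      linarith [hineq]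
  · simp at hnum

end Literature.NumberTheory.LFunctions.RSCert
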